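import Summits.Parity.GeneralizedHardyLittlewood.Theorems.BeyondDiagonalBeatsQuarter.PeterssonSplit
import Summits.Parity.GeneralizedHardyLittlewood.Theorems.BeyondDiagonalBeatsQuarter.CleanScales
import HarnessLib

/-!
# Route `PrimeLevelFamEdge`, crux K_B (stmt-Parity-20343), line `diagonal_kernel_split` rev 4:
# the ENTRY POINTS of plan Ω for the sharpened heart `stub_offDiagBelowSlack_io` —
# «block bound for the mollified off-diagonal at CLEAN scales ⇒ OFF_io,U», in both quantifier orders

Rev 4 registers the heart as OFF_io,U (pointwise, i.o. along good primes, on the explicit series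
`PeterssonSplit.offDiag`). What plan Ω actually proves is a BLOCK inequality at Landau–Page-clean scales
(STUB-PLAN §4; GATE G1/G2): `Σ_{q ∈ goodPrimes Δ′ N} O(Δ′,q) ≤ U·Σ_q mainScaleReal Δ′ q` with
`O(Δ′,q) = −re Σ_{l,m ≤ q̂^{Δ′}} c_l c_m·offDiag q l m`. This file (the off-diagonal twin of `CleanScales.lean`):
`offDiagMollified` (the pointwise mollified off-diagonal, total in `q`), `offDiagMollified_eq`,
`offDiag_io_of_block_io` (block ⇒ pointwise: a sum ≤ a sum over a non-empty block has a good term), and the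
two compositions with the recurrence of clean scales — `offDiagBelowSlack_io_of_blockAtCleanScales` (`a₀`
first, `cleanScales_io`) and `offDiagBelowSlack_io_of_blockAtCleanScales_pointwise` (`c′₀` handed first, `a₀`
after `Δ′`, `cleanScales_io_explicit`; the order under which an η-free resonance bound still closes,
`OmegaWindow.omega_resonanceRow_nonempty_pointwise`). Conclusions are `stub_offDiagBelowSlack_io` VERBATIM.
Pure logic; the block bound is displayed as the hypothesis (OPEN, plan Ω). Standard axioms.
«The programme SEARCHES and TYPES; no claim about Landau–Siegel zeros, Theorems 1–2 of arXiv:2211.02515 or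
a repaired Margin232 until a kernel theorem says so.»
-/

noncomputable section

open Finset Polynomial
open scoped Real

namespace Summit.Parity.GeneralizedHardyLittlewood.Theorems.BeyondDiagonalBeatsQuarter.PeterssonSplit

open Literature.NumberTheory.LFunctions Literature.NumberTheory.LFunctions.KMV2000

/-- **Pointwise mollified off-diagonal** at level `q` and length exponent `Δ′` (total in `q`; `0` at `q = 0`):
`O(Δ′, q) = −re Σ_{l,m ≤ q̂^{Δ′}} c_l c_m·offDiag q l m`, `c_m = mollifierCoeff X² q̂^{Δ′} m` — the left side of
the rev-4 heart `stub_offDiagBelowSlack_io`. [cite: KowalskiMichelVanderKam2000, (21)–(23) p. 12 and Lemma 3.3 p. 9 — derivation] -/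
def offDiagMollified (Δ' : ℝ) (q : ℕ) : ℝ :=
  if hq : q = 0 then 0 else
    (haveI : NeZero q := ⟨hq⟩;
      -(∑ l ∈ Icc 1 ⌊qhat q ^ Δ'⌋₊, ∑ m ∈ Icc 1 ⌊qhat q ^ Δ'⌋₊,
          ((mollifierCoeff (X ^ 2) (qhat q ^ Δ') l * mollifierCoeff (X ^ 2) (qhat q ^ Δ') m : ℝ) : ℂ) *
            offDiag q l m).re)

/-- Unfolding `offDiagMollified` at a non-zero level: verbatim the rev-4 heart's left side.
[cite: KowalskiMichelVanderKam2000, (21)–(23) p. 12 — derivation] -/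
theorem offDiagMollified_eq (Δ' : ℝ) (q : ℕ) [NeZero q] :
    offDiagMollified Δ' q =
      -(∑ l ∈ Icc 1 ⌊qhat q ^ Δ'⌋₊, ∑ m ∈ Icc 1 ⌊qhat q ^ Δ'⌋₊,
          ((mollifierCoeff (X ^ 2) (qhat q ^ Δ') l * mollifierCoeff (X ^ 2) (qhat q ^ Δ') m : ℝ) : ℂ) *
            offDiag q l m).re := by
  unfold offDiagMollified
  rw [dif_neg (NeZero.ne q)]

/-- **Block control infinitely often ⇒ pointwise control infinitely often** for the mollified off-diagonal
(a sum `≤` a sum over a non-empty block of good primes has a term `≤` the corresponding term).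
[cite: KowalskiMichelVanderKam2000, §2 p. 7 (M ∉ ℤ), §6 p. 19] -/
theorem offDiag_io_of_block_io {Δ' U : ℝ}
    (h : ∀ N₀ : ℕ, ∃ N : ℕ, N₀ ≤ N ∧ (goodPrimes Δ' N).Nonempty ∧
      ∑ q ∈ goodPrimes Δ' N, offDiagMollified Δ' q ≤ U * ∑ q ∈ goodPrimes Δ' N, mainScaleReal Δ' q) :
    ∀ q₀ : ℕ, ∃ q : ℕ, ∃ _ : NeZero q, q₀ ≤ q ∧ q.Prime ∧
      (∀ n : ℕ, (n : ℝ) ≠ qhat q ^ Δ') ∧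
        -(∑ l ∈ Icc 1 ⌊qhat q ^ Δ'⌋₊, ∑ m ∈ Icc 1 ⌊qhat q ^ Δ'⌋₊,
            ((mollifierCoeff (X ^ 2) (qhat q ^ Δ') l * mollifierCoeff (X ^ 2) (qhat q ^ Δ') m : ℝ) : ℂ) *
              offDiag q l m).re ≤ U * mainScaleReal Δ' q := by
  intro q₀
  obtain ⟨N, hNge, hNne, hsum⟩ := h q₀
  rw [Finset.mul_sum] at hsum
  obtain ⟨q, hqmem, hqle⟩ := Finset.exists_le_of_sum_le hNne hsum
  obtain ⟨hqN, -, hqp, hqg⟩ := mem_goodPrimes_iff.mp hqmem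
  haveI : NeZero q := ⟨hqp.ne_zero⟩
  refine ⟨q, inferInstance, by omega, hqp, fun n ↦ by simpa [qhat] using hqg n, ?_⟩
  rwa [offDiagMollified_eq] at hqle

/-- **Plan Ω's entry point (a₀ first): block bound for the off-diagonal at CLEAN scales ⇒ OFF_io,U
(`stub_offDiagBelowSlack_io` verbatim).** [cite: MontgomeryVaughan2007, Cor. 11.10 (Page); KowalskiMichelVanderKam2000, §6 p. 19] -/
theorem offDiagBelowSlack_io_of_blockAtCleanScales
    (hΩ : ∃ a₀ : ℝ, 0 < a₀ ∧ ∀ η₀ : ℝ, 0 < η₀ → ∃ b : ℝ, 1 < b ∧ ∀ Δ' : ℝ, 1 < Δ' → Δ' < b →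
      ∃ U : ℝ, U < 4 * (Δ' - 1) / Δ' ∧ ∃ η' : ℝ, 0 < η' ∧ η' < η₀ ∧ ∃ N₀ : ℕ, ∀ N : ℕ, N₀ ≤ N →
        CleanScale a₀ η' N → (goodPrimes Δ' N).Nonempty ∧
          ∑ q ∈ goodPrimes Δ' N, offDiagMollified Δ' q ≤ U * ∑ q ∈ goodPrimes Δ' N, mainScaleReal Δ' q) :
    ∃ b : ℝ, 1 < b ∧ ∀ Δ' : ℝ, 1 < Δ' → Δ' < b → ∃ U : ℝ, U < 4 * (Δ' - 1) / Δ' ∧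
      ∀ q₀ : ℕ, ∃ q : ℕ, ∃ _ : NeZero q, q₀ ≤ q ∧ q.Prime ∧
        (∀ n : ℕ, (n : ℝ) ≠ qhat q ^ Δ') ∧
          -(∑ l ∈ Icc 1 ⌊qhat q ^ Δ'⌋₊, ∑ m ∈ Icc 1 ⌊qhat q ^ Δ'⌋₊,
              ((mollifierCoeff (X ^ 2) (qhat q ^ Δ') l * mollifierCoeff (X ^ 2) (qhat q ^ Δ') m : ℝ) : ℂ) *
                offDiag q l m).re ≤ U * mainScaleReal Δ' q := by
  obtain ⟨a₀, ha₀, H⟩ := hΩ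
  obtain ⟨η₀, hη₀, Hc⟩ := cleanScales_io ha₀
  obtain ⟨b, hb, Hb⟩ := H η₀ hη₀
  refine ⟨b, hb, fun Δ' h1 h2 ↦ ?_⟩
  obtain ⟨U, hU, η', hη', hη'₀, N₀, HN⟩ := Hb Δ' h1 h2
  refine ⟨U, hU, offDiag_io_of_block_io fun N₁ ↦ ?_⟩
  obtain ⟨N, hN, -, hclean⟩ := Hc η' hη' hη'₀ (max N₀ N₁)
  exact ⟨N, le_trans (le_max_right _ _) hN, HN N (le_trans (le_max_left _ _) hN) hclean⟩

/-- **Plan Ω's entry point (c′₀ first, a₀ after Δ′): the order under which an η-free resonance bound still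
closes** — conclusion again `stub_offDiagBelowSlack_io` verbatim.
[cite: MontgomeryVaughan2007, Cor. 11.10 (Page); KowalskiMichelVanderKam2000, §6 p. 19] -/
theorem offDiagBelowSlack_io_of_blockAtCleanScales_pointwise
    (hΩ : ∀ c₀' : ℝ, 0 < c₀' → ∃ b : ℝ, 1 < b ∧ ∀ Δ' : ℝ, 1 < Δ' → Δ' < b →
      ∃ U : ℝ, U < 4 * (Δ' - 1) / Δ' ∧ ∃ a₀ : ℝ, 0 < a₀ ∧ ∃ η' : ℝ, 0 < η' ∧ η' < c₀' / a₀ ∧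
        ∃ N₀ : ℕ, ∀ N : ℕ, N₀ ≤ N → CleanScale a₀ η' N → (goodPrimes Δ' N).Nonempty ∧
          ∑ q ∈ goodPrimes Δ' N, offDiagMollified Δ' q ≤ U * ∑ q ∈ goodPrimes Δ' N, mainScaleReal Δ' q) :
    ∃ b : ℝ, 1 < b ∧ ∀ Δ' : ℝ, 1 < Δ' → Δ' < b → ∃ U : ℝ, U < 4 * (Δ' - 1) / Δ' ∧
      ∀ q₀ : ℕ, ∃ q : ℕ, ∃ _ : NeZero q, q₀ ≤ q ∧ q.Prime ∧
        (∀ n : ℕ, (n : ℝ) ≠ qhat q ^ Δ') ∧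
          -(∑ l ∈ Icc 1 ⌊qhat q ^ Δ'⌋₊, ∑ m ∈ Icc 1 ⌊qhat q ^ Δ'⌋₊,
              ((mollifierCoeff (X ^ 2) (qhat q ^ Δ') l * mollifierCoeff (X ^ 2) (qhat q ^ Δ') m : ℝ) : ℂ) *
                offDiag q l m).re ≤ U * mainScaleReal Δ' q := by
  obtain ⟨c₀', hc₀', Hc⟩ := cleanScales_io_explicit
  obtain ⟨b, hb, Hb⟩ := hΩ c₀' hc₀'
  refine ⟨b, hb, fun Δ' h1 h2 ↦ ?_⟩
  obtain ⟨U, hU, a₀, ha₀, η', hη', hη'₀, N₀, HN⟩ := Hb Δ' h1 h2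
  refine ⟨U, hU, offDiag_io_of_block_io fun N₁ ↦ ?_⟩
  obtain ⟨N, hN, -, hclean⟩ := Hc a₀ ha₀ η' hη' hη'₀ (max N₀ N₁)
  exact ⟨N, le_trans (le_max_right _ _) hN, HN N (le_trans (le_max_left _ _) hN) hclean⟩

end Summit.Parity.GeneralizedHardyLittlewood.Theorems.BeyondDiagonalBeatsQuarter.PeterssonSplit
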